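import Summits.Ventures.CertifiedQuantumChemistry.Hamiltonians.Tables
import Summits.Ventures.CertifiedQuantumChemistry.Rows.ModelPin
import HarnessLib

/-!
# Ventures/CertifiedQuantumChemistry — Hamiltonians/TablesEightfold.lean: a literal model from canonical
# tables satisfies the FULL 8-fold rule `Model.IsEightfold`

HONEST FRAMING (verbatim): certified bounds for a stated model Hamiltonian in a stated basis; not a
claim about the real molecule or material beyond that model.

`Hamiltonians/Tables.lean` (`Model.ofTables`, `Model.ofTables_isSymmetric`) keys the two-electron table by
the canonical representative `quadKey p q r s` of the 8-fold orbit of `(pq|rs)` (sort each pair, then put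
the lexicographically smaller pair first — reader A's `canon_eri_key`, FORMAT-pin1). It records only the
MINIMAL rule `Model.IsSymmetric` (`h_pq = h_qp`, `(pq|rs) = (qp|sr)`). The derived-table rows of the
sector-difference kernel (`Rows/HoleTransferRows.diffUpperRow_of_transferHole…`,
`Rows/ParticleTransferRows.diffUpperRow_of_transferParticle…`) ask for the full rule `Model.IsEightfold`
(`Rows/ModelPin.lean`: additionally `(pq|rs) = (qp|rs)`, `(pq|rs) = (pq|sr)`, `(pq|rs) = (rs|pq)`), because
the operator identity `Ĥ(K) = μ·Ĥ(F) + t·𝔾 − 𝕏` of the tool's 8-fold-symmetrised table needs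
`(pq|rs) = (pq|sr)`. This file proves that rule ONCE for every table model — `Model.ofTables_isEightfold` —
so that a per-row `Certificates/` file on a literal model (`n2Sto6gRe`, `li3ps4…`, …) discharges the
`IsEightfold` binder by this lemma instead of a `decide` over `k⁴` entries (the canonical key is invariant
under each generator of the 8-fold group: `quadKey_swap_left`, `quadKey_swap_right`, `quadKey_pairSwap`).
Typer chem-type-09 (LADDER-CHEM I-TYPE slot 09; needed by the door-«s» instance cells, chem-lead B8-1).
Elementary; nothing about any pinned file is asserted. [folklore]
-/

namespace Summit.Ventures.CertifiedQuantumChemistry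

/-- Sorting the left pair does not change the canonical key: `quadKey p q r s = quadKey q p r s`. [folklore] -/
theorem quadKey_swap_left (p q r s : ℕ) : quadKey p q r s = quadKey q p r s := by
  simp only [quadKey, pairKey_comm q p]

/-- Sorting the right pair does not change the canonical key: `quadKey p q r s = quadKey p q s r`. [folklore] -/
theorem quadKey_swap_right (p q r s : ℕ) : quadKey p q r s = quadKey p q s r := by
  simp only [quadKey, pairKey_comm s r]

/-- `pairLE` is antisymmetric and total, so ordering the two sorted pairs is symmetric in the pairs:
`quadKey p q r s = quadKey r s p q` (the `(pq|rs) = (rs|pq)` generator). [folklore] -/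
theorem quadKey_pairSwap (p q r s : ℕ) : quadKey p q r s = quadKey r s p q := by
  unfold quadKey
  generalize pairKey p q = a
  generalize pairKey r s = b
  obtain ⟨a1, a2⟩ := a
  obtain ⟨b1, b2⟩ := b
  simp only [pairLE, Bool.or_eq_true, Bool.and_eq_true, decide_eq_true_eq]
  split_ifs with h1 h2 h2
  · simp only [Prod.mk.injEq]; omega
  · rfl
  · rfl
  · simp only [Prod.mk.injEq]; omega

namespace Model

variable {k : ℕ}

/-- **A literal model from canonical tables is 8-fold symmetric** (`Model.IsEightfold` of
`Rows/ModelPin.lean`: `h_pq = h_qp`, `(pq|rs) = (qp|rs) = (pq|sr) = (rs|pq)`), for ANY tables — each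
generator of the 8-fold group fixes the canonical key under which `Model.ofTables` looks the entry up.
Discharges the `hF : F.IsEightfold` binder of the hole- and particle-transfer rows for every
`Hamiltonians/<Name>.lean` model. [folklore] -/
theorem ofTables_isEightfold (k : ℕ) (hT : List ((ℕ × ℕ) × (ℤ × ℕ)))
    (eT : List (((ℕ × ℕ) × (ℕ × ℕ)) × (ℤ × ℕ))) (ecore : ℚ) : (ofTables k hT eT ecore).IsEightfold := by
  refine ⟨fun p q => ?_, fun p q r s => ?_, fun p q r s => ?_, fun p q r s => ?_⟩
  · simp only [ofTables, pairKey_comm p.val q.val]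
  · simp only [ofTables, quadKey_swap_left p.val q.val r.val s.val]
  · simp only [ofTables, quadKey_swap_right p.val q.val r.val s.val]
  · simp only [ofTables, quadKey_pairSwap p.val q.val r.val s.val]

end Model

end Summit.Ventures.CertifiedQuantumChemistry
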